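import Summits.BirchSwinnertonDyer.BirchSwinnertonDyer.Theorems.QuadraticBranchSignedControlPlusEtaLowerInclusionRankZeroPairs
import Literature.NumberTheory.EllipticCurves.KuriharaNumberKimShaLength
import Literature.NumberTheory.EllipticCurves.ComplexMultiplication
import Literature.NumberTheory.DiophantineGeometry.LocalReductionMinimalityProofs
import Literature.NumberTheory.DiophantineGeometry.LocalReductionFiniteBadPlacesProofs
import Literature.NumberTheory.GaloisRepresentations.HeckeCharacterProofs
import HarnessLib

/-!
# Route `QuadraticBranchSignedControl` (rung K8, cell `bsd-potss`), crux `PlusEtaLowerInclusion`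
# (item stmt-BirchSwinnertonDyer-19601): the BC5 rung `stub_etaLower_rung_39675m1` — (E⁺_η) at
# `p = 5` for the good twist of `W₀ = 39675m1` — from Kobayashi 2.2/4.1 at `η`, Kitajima–Otsuki,
# modularity (named facts) and the unit-Kurihara-number row of `W₀` read through Kim 2026 Thm. 1.8 (6)

WHAT. The registered stub `Sig.stub_etaLower_rung_39675m1` of the birth skeleton of crux 19601
(planner bsd-potss-plan g14, `Cruxes/PlusEtaLowerInclusion`; «BC5 PLAN-ONLY rung, not consumed by
`_of`») reads, with `W39675m1 := ⟨0, −1, 1, −506958, −159508807⟩` (Cremona `39675m1`, `N = 3·5²·23²`):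
for every globally minimal `V` with `C • W39675m1^{(5)} = V`, good at `5`, `a₅(V) = 0`, onto `5`-adic
tower, `QuadraticBranchPlusEtaLowerInclusionAt V 5`. THIS FILE derives it (statement VERBATIM, the
skeleton's `W39675m1` unfolded) from the sibling tool file's
`quadraticBranchPlusEtaLowerInclusionAt_of_namedFacts_of_selmerWitness` in two shapes:
* §1 the explicit curve: `Δ(W₀) = −2676033200149171875 = −3⁷·5⁶·23⁸` (`Δ_39675m1`), `W₀` is
  elliptic (`isElliptic_39675m1`) and GLOBALLY MINIMAL (`isGloballyMinimal_39675m1`: integral, and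
  `ord_ℓ Δ < 12` at every prime since no `ℓ¹²` divides `|Δ|` — Silverman VII.1 Rem. 1.1, tree
  `isMinimalAt_of_lt_valuation_Δ_holds`) — PROVED, so the rung carries no model hypothesis;
* §2 the general COMPOSITION with Kim's theorem: for any tower-onto Gss2 pair `(V, W, p ≥ 5)`,
  the named facts + GZK + `Kim2022_rankZero_padicValRat_sha_of_kuriharaNumber_ne_zero_of_maninConstant`
  + Kim's INPUTS at the pair (`ρ̄_{W,p}` onto, `L(W,1) ≠ 0`, a modular parametrisation datum with
  Manin constant prime to `p`, the period transfer, a level `n ∈ 𝒩₁` with cyclic `Ẽ(𝔽_ℓ)[p]` and a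
  NON-ZERO mod-`p` Kurihara number `δ̃_n`) ⟹ (E⁺_η)(V, p)
  (`quadraticBranchPlusEtaLowerInclusionAt_of_namedFacts_of_kim`);
* §3 THE RUNG: `stub_etaLower_rung_39675m1_of_namedFacts_of_selmerWitness` (Kim's OUTPUT shape:
  `L(W₀,1) ≠ 0` and «`L(W₀,1)/Ω = q`, `v₅(q) ≤ ord₅ #Sel_{5^∞}(W₀/ℚ)`» displayed) and
  `stub_etaLower_rung_39675m1_of_namedFacts_of_kim` (Kim's INPUT shape at `(W₀, 5, n = 6541 = 31·211)`:
  exactly the data of the certified record `X4.KimAdditiveRecordsExt.cert_X4ext_39675m1_p5` —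
  `δ̃₆₅₄₁ ≡ 2 (mod 5)` on three engines (harvest-2 GEN 15 kit j093174 / j093175 / j093207; additive-p4
  GEN 22 row), `r_an = 0`, `[0]⁺ = 50`, `#Ш_an = 25`, `∏ c_ℓ = 2`, `#tors = 1`, `ρ̄_{W₀,5}` onto).

HONEST FRAMING (cell `bsd-potss`, run/shared/lean/pub/bsd-potss/; FULL-BSD rank ≤ 1 programme,
HUMAN RULING D-0036/D-0074/D-0088(2)): the rung is CONDITIONAL — on NAMED Literature facts in
hypothesis position (Kobayashi 2003 Thm. 2.2 / 4.1 at `η`, Kitajima–Otsuki 2018 Thm. 1.3, modularity;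
in the Kim shape also GZK and Kim 2026 Thm. 1.8 (6)) and on the DISPLAYED per-pair COMPUTATIONS for
`W₀` (`L(W₀,1) ≠ 0`; the Kurihara number / its Kim output) — it is NOT the unconditional
`theorem stub_etaLower_rung_39675m1 : Sig.stub_etaLower_rung_39675m1`, hence lands `--as helper`
(the registered signature has no fact hypotheses; a by-name landing would need the planner to register
the conditional form). Crux 19601 stays OPEN; nothing is booked; no label / mark / count moves;
`BSD(W₀, 5)` is not claimed here; no definition, no named fact minted, no `sorry`, axioms standard.
Seat `bsd-potss-k8-rung` (prover), g0; `--supports stmt-BirchSwinnertonDyer-19601 --as helper`.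

References: [Kobayashi2003] Thm. 2.2 (p. 5), (3.6) (p. 7), §4 + Thm. 4.1 (p. 8), Thm. 9.3 (p. 26);
[KitajimaOtsuki2018] Main Thm. 1.3; [Kim2022StructureSelmer] Thm. 1.9 (1), (6) (PDF pp. 7–8) = journal
Thm. 1.8; [SilvermanAEC2009] VII.1 Remark 1.1, VIII.8; [Cremona2006] (label `39675m1`).
-/

set_option autoImplicit false
set_option linter.dupNamespace false

noncomputable section

open scoped Classical

open CongruenceSubgroup Field WeierstrassCurve NumberField IsDedekindDomain Rat.HeightOneSpectrum
open Literature.NumberTheory.EllipticCurves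
open Literature.NumberTheory.EllipticCurves.ModularForms
open Literature.NumberTheory.GaloisRepresentations
open Summit.BirchSwinnertonDyer.Rank1Residual.Additive

namespace Summit.BirchSwinnertonDyer.BirchSwinnertonDyer.Theorems

/-! ## §1 The explicit curve `W₀ = 39675m1`: discriminant, ellipticity, global minimality -/

/-- `Δ(W₀) = −2676033200149171875` (`= −3⁷·5⁶·23⁸`) for `W₀ = [0, −1, 1, −506958, −159508807]`
(Cremona `39675m1`). [folklore] -/
theorem Δ_39675m1 :
    (⟨0, -1, 1, -506958, -159508807⟩ : WeierstrassCurve ℚ).Δ = -2676033200149171875 := by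
  norm_num [WeierstrassCurve.Δ, WeierstrassCurve.b₂, WeierstrassCurve.b₄, WeierstrassCurve.b₆,
    WeierstrassCurve.b₈]

/-- `W₀ = 39675m1` is an elliptic curve (`Δ ≠ 0`). [folklore] -/
theorem isElliptic_39675m1 : (⟨0, -1, 1, -506958, -159508807⟩ : WeierstrassCurve ℚ).IsElliptic :=
  ⟨by rw [Δ_39675m1, isUnit_iff_ne_zero]; norm_num⟩

/-- No twelfth power of a prime divides `|Δ(W₀)| = 3⁷·5⁶·23⁸` (a prime `q` with `q¹² ∣ |Δ|` has
`q < 35`; the finitely many cases are decided). [folklore] -/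
theorem not_prime_pow_twelve_dvd_Δ_39675m1 (q : ℕ) (hq : q.Prime) :
    ¬ q ^ 12 ∣ 2676033200149171875 := by
  intro h
  have hle : q ^ 12 ≤ 2676033200149171875 := Nat.le_of_dvd (by norm_num) h
  have hq35 : q < 35 := by
    by_contra h35
    have h35' : 35 ≤ q := by omega
    have : 35 ^ 12 ≤ q ^ 12 := Nat.pow_le_pow_left h35' 12
    omega
  interval_cases q <;> first | exact absurd hq (by decide) | exact absurd h (by decide)

/-- **`W₀ = 39675m1` is a global minimal Weierstrass equation**: its coefficients are integers and at
every prime `ℓ`, `ord_ℓ Δ(W₀) < 12` (`|Δ| = 3⁷·5⁶·23⁸`), so the equation is minimal at `ℓ`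
(Silverman VII.1 Remark 1.1, tree `isMinimalAt_of_lt_valuation_Δ_holds`). Hence the tree's
invariants of global minimal models (`realPeriodRat`, `integralModelInt`, `frobeniusTrace`, Tamagawa
numbers) are those of THIS equation — Cremona's reduced minimal model.
[cite: SilvermanAEC2009, VII.1 Remark 1.1 and VIII.8 (global minimal models)] -/
theorem isGloballyMinimal_39675m1 :
    (⟨0, -1, 1, -506958, -159508807⟩ : WeierstrassCurve ℚ).IsGloballyMinimal where
  isIntegral := isIntegral_of_exists_lift _ ⟨0, by simp⟩ ⟨-1, by simp⟩ ⟨1, by simp⟩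
    ⟨((-506958 : ℤ) : 𝓞 ℚ), by rw [map_intCast]; norm_num⟩
    ⟨((-159508807 : ℤ) : 𝓞 ℚ), by rw [map_intCast]; norm_num⟩
  isMinimal v := by
    have hint : ∀ n : ℤ, v.valuation ℚ (n : ℚ) ≤ 1 := fun n => by
      rw [Rat.valuation_intCast]; exact HeightOneSpectrum.intValuation_le_one v _
    refine isMinimalAt_of_lt_valuation_Δ_holds
      ((⟨0, -1, 1, -506958, -159508807⟩ : WeierstrassCurve ℚ).isIntegralAt_of_valuation_le_one v
        ?_ ?_ ?_ ?_ ?_) ?_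
    · change v.valuation ℚ (0 : ℚ) ≤ 1; rw [map_zero]; exact zero_le
    · change v.valuation ℚ (-1 : ℚ) ≤ 1; exact_mod_cast hint (-1)
    · change v.valuation ℚ (1 : ℚ) ≤ 1; exact_mod_cast hint 1
    · change v.valuation ℚ (-506958 : ℚ) ≤ 1; exact_mod_cast hint (-506958)
    · change v.valuation ℚ (-159508807 : ℚ) ≤ 1; exact_mod_cast hint (-159508807)
    · rw [Δ_39675m1]
      have hcast : ((-2676033200149171875 : ℤ) : ℚ) = -2676033200149171875 := by norm_num
      have h12 : (-12 : ℤ) = -((12 : ℕ) : ℤ) := by norm_num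
      rw [← hcast, Rat.valuation_intCast, ← not_le, h12, HeightOneSpectrum.intValuation_le_pow_iff_mem]
      intro hmem
      rw [Rat.asIdeal_eq_span_natGenerator, Ideal.span_singleton_pow, Ideal.mem_span_singleton] at hmem
      have h := map_dvd (Rat.ringOfIntegersEquiv : 𝓞 ℚ →+* ℤ) hmem
      rw [map_pow, map_natCast, map_intCast, Int.cast_id] at h
      have hdvd' : natGenerator v ^ 12 ∣ 2676033200149171875 := by exact_mod_cast dvd_neg.mp h
      exact not_prime_pow_twelve_dvd_Δ_39675m1 _ (prime_natGenerator v) hdvd'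

/-! ## §2 The composition with Kim's theorem (any tower-onto rank-zero Gss2 pair, `p ≥ 5`) -/

section Kim

variable {V : WeierstrassCurve ℚ} [V.IsElliptic] [V.IsGloballyMinimal] {p : ℕ} [hp : Fact p.Prime]

/-- **(E⁺_η) at a tower-onto rank-zero pair from the named facts and Kim's INPUTS at the pair.**
Named facts: Kobayashi Thm. 2.2 / 4.1 at `η`, Kitajima–Otsuki Thm. 1.3, modularity, GZK (rank and
finiteness of `Ш` in analytic rank `0`), and Kim 2026 Thm. 1.8 (6) in its additive-prime rank-zero
unit-Kurihara-number form. Per pair (the `p*`-partner `W`, globally minimal): `ρ̄_{W,p}` onto,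
`L(W,1) ≠ 0`, a modular parametrisation datum `D` with `p ∤` its Manin constant, the period transfer
`Ω(W) = u·Ω⁺_{D.f}` (`|u|_p = 1`), a Kolyvagin level `n ∈ 𝒩₁` all of whose primes have
`#Ẽ(𝔽_ℓ)[p] ≤ p`, and surjective discrete logarithms `ψ` with `kuriharaNumber D.f p n ψ ≠ 0`. Kim's
theorem yields `L(W,1)/Ω_W = q` with `v_p(q) = ord_p #Ш(W)(p)`; the sibling's `…_of_shaWitness`
concludes. CONDITIONAL; closes nothing class-wide; `BSD(W, p)` not claimed here.
[cite: Kim2022StructureSelmer, Thm. 1.9 (1) and (6) (PDF pp. 7–8), §1.4.3 (PDF p. 7)]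
[cite: Kobayashi2003, §4 + Thm. 4.1 (p. 8), Thm. 9.3 (p. 26)] [cite: KitajimaOtsuki2018, Main Thm. 1.3] -/
theorem quadraticBranchPlusEtaLowerInclusionAt_of_namedFacts_of_kim
    (h22 : Kobayashi2003.thm22_etaSignedSelmerDual_finite_torsion)
    (h41 : Kobayashi2003.thm41_plusEtaCharIdeal_dvd)
    (hKO : KitajimaOtsuki2018.mainThm13_etaSignedSelmerDual_noFiniteSubmodule)
    (hmod : hasEntireLFunction_rat) (hGZK : rank_eq_analyticRank_of_analyticRank_le_one)
    (hKim : Kim2022_rankZero_padicValRat_sha_of_kuriharaNumber_ne_zero_of_maninConstant)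
    (W : WeierstrassCurve ℚ) [W.IsElliptic] [W.IsGloballyMinimal] (C : VariableChange ℚ)
    (hp5 : 5 ≤ p) (hCV : C • W.quadraticTwist ((-1) ^ (p / 2) * p) = V)
    (hsurj : ∀ m : ℕ, V.HasSurjectiveModNGaloisRep (p ^ m : ℕ))
    (hsurjW : W.HasSurjectiveModNGaloisRep p) (hLW : W.entireLFunction 1 ≠ 0)
    {N : ℕ} [NeZero N] (D : ModularParametrizationData W N) (hc : ¬ (p : ℤ) ∣ D.maninConstant)
    (hu : ∃ u : ℚ, ‖(u : ℚ_[p])‖ = 1 ∧ W.realPeriodRat = u * plusPeriod D.f)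
    (n : ℕ) [NeZero n] (hn : Kato.IsKolyvaginProduct W p 1 n)
    (hcyc : ∀ (ℓ : ℕ) [Fact ℓ.Prime], ℓ ∣ n →
      Nat.card {P : ((WeierstrassCurve.integralModelInt W).map
          (Int.castRingHom (ZMod ℓ))).toAffine.Point // p • P = 0} ≤ p)
    (ψ : (ℓ : ℕ) → (ZMod ℓ)ˣ →* Multiplicative (ZMod (p ^ 1)))
    (hψ : ∀ ℓ ∈ n.primeFactors, Function.Surjective (ψ ℓ))
    (hδ : kuriharaNumber D.f (p ^ 1) n ψ ≠ 0) :
    QuadraticBranchPlusEtaLowerInclusionAt V p := by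
  -- GZK in analytic rank `0`: `Ш(W)` is finite
  have hr0 : W.analyticRank = 0 := analyticRank_eq_zero_of_entireLFunction_one_ne_zero W hLW
  have hfin : Finite W.sha := (hGZK W (by rw [hr0]; exact zero_le_one)).2
  -- Kim's theorem: `L(W,1)/Ω_W = q`, `v_p(q) = ord_p #Ш(W)(p)`
  obtain ⟨q, hq, hval⟩ := hKim W p hp5 hsurjW hLW hfin D hc hu n hn
    (fun ℓ _ hℓ => hcyc ℓ hℓ) ψ hψ hδ
  exact quadraticBranchPlusEtaLowerInclusionAt_of_namedFacts_of_shaWitness h22 h41 hKO hmod hGZK W C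
    hCV hsurj hLW ⟨q, hq, hval.le⟩

end Kim

/-! ## §3 The BC5 rung of crux 19601: `W₀ = 39675m1`, `p = 5` -/

/-- **THE RUNG `stub_etaLower_rung_39675m1` (Kim's OUTPUT shape).** Statement =
`Sig.stub_etaLower_rung_39675m1` VERBATIM (the skeleton's `W39675m1` unfolded), from: Kobayashi
Thm. 2.2 / 4.1 at `η`, Kitajima–Otsuki Thm. 1.3, modularity (NAMED facts, hypotheses); `L(W₀,1) ≠ 0`
(`r_an(39675m1) = 0`); and the lower `5`-part witness «`L(W₀,1)/Ω = q`,
`v₅(q) ≤ ord₅ #Sel_{5^∞}(W₀/ℚ)`» — the output of Kim 2026 Thm. 1.8 (6) on the UNIT Kurihara number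
`δ̃₆₅₄₁` of the record `X4.KimAdditiveRecordsExt.cert_X4ext_39675m1_p5` (see the Kim-shape twin below;
`[0]⁺ = 50`, `#Ш_an = 25`). `W₀` is elliptic and globally minimal by §1 (no model hypothesis).
CONDITIONAL; «not consumed by `_of`»; crux 19601 stays OPEN; nothing booked.
[cite: Kobayashi2003, Thm. 2.2 (p. 5), (3.6) (p. 7), §4 + Thm. 4.1 (p. 8), Thm. 9.3 (p. 26)]
[cite: KitajimaOtsuki2018, Main Thm. 1.3] [cite: Kim2022StructureSelmer, Thm. 1.9 (6) (PDF pp. 7–8)] -/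
theorem stub_etaLower_rung_39675m1_of_namedFacts_of_selmerWitness
    (h22 : Kobayashi2003.thm22_etaSignedSelmerDual_finite_torsion)
    (h41 : Kobayashi2003.thm41_plusEtaCharIdeal_dvd)
    (hKO : KitajimaOtsuki2018.mainThm13_etaSignedSelmerDual_noFiniteSubmodule)
    (hmod : hasEntireLFunction_rat)
    (hLW : (⟨0, -1, 1, -506958, -159508807⟩ : WeierstrassCurve ℚ).entireLFunction 1 ≠ 0)
    (hwit : ∃ q : ℚ, (⟨0, -1, 1, -506958, -159508807⟩ : WeierstrassCurve ℚ).entireLFunction 1 /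
        ((⟨0, -1, 1, -506958, -159508807⟩ : WeierstrassCurve ℚ).realPeriodRat : ℂ) = (q : ℂ) ∧
      padicValRat 5 q ≤ (padicValNat 5 (Nat.card
        ↥((⟨0, -1, 1, -506958, -159508807⟩ : WeierstrassCurve ℚ).selmerGroupPInfty 5)) : ℤ)) :
    ∀ (V : WeierstrassCurve ℚ) [V.IsElliptic] [V.IsGloballyMinimal] [Fact (5 : ℕ).Prime],
      (∃ C : VariableChange ℚ,
        C • (⟨0, -1, 1, -506958, -159508807⟩ : WeierstrassCurve ℚ).quadraticTwist 5 = V) →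
      V.HasGoodReductionAtPrime 5 → V.frobeniusTrace 5 = 0 →
      (∀ m : ℕ, V.HasSurjectiveModNGaloisRep (5 ^ m : ℕ)) →
        QuadraticBranchPlusEtaLowerInclusionAt V 5 := by
  intro V _ _ _ hC _ _ hsurj
  obtain ⟨C, hCV⟩ := hC
  haveI := isElliptic_39675m1
  haveI := isGloballyMinimal_39675m1
  have h5 : ((-1 : ℚ) ^ ((5 : ℕ) / 2) * ((5 : ℕ) : ℚ)) = 5 := by norm_num
  have hCV' : C • (⟨0, -1, 1, -506958, -159508807⟩ : WeierstrassCurve ℚ).quadraticTwist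
      ((-1 : ℚ) ^ ((5 : ℕ) / 2) * ((5 : ℕ) : ℚ)) = V := by rw [h5]; exact hCV
  exact quadraticBranchPlusEtaLowerInclusionAt_of_namedFacts_of_selmerWitness h22 h41 hKO hmod _ C
    hCV' hsurj hLW hwit

/-- **THE RUNG `stub_etaLower_rung_39675m1` (Kim's INPUT shape).** Statement =
`Sig.stub_etaLower_rung_39675m1` VERBATIM, from the NAMED facts (Kobayashi 2.2 / 4.1 at `η`,
Kitajima–Otsuki 1.3, modularity, GZK, Kim 2026 Thm. 1.8 (6)) and Kim's INPUTS for `W₀ = 39675m1` at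
`p = 5`, DISPLAYED — exactly the content of the certified record
`X4.KimAdditiveRecordsExt.cert_X4ext_39675m1_p5` and its documented warrants: `ρ̄_{W₀,5}` onto (no
galrep code at `5`), `L(W₀,1) ≠ 0` (`r_an = 0`), a modular parametrisation datum with `5 ∤` Manin
constant (optimal curve, Agashe–Ribet–Stein Thm. 2.6 / 5.2: `c = 1`), the period transfer
`Ω(W₀) = u·Ω⁺_f` with `|u|₅ = 1` (spelled `padicNorm 5 u = 1`, no instance needed), the level
`n = 6541 = 31·211 ∈ 𝒩₁` (`31, 211 ≡ 1 (mod 5)`, `a₃₁ = −8 ≡ 2`, `a₂₁₁ = −13 ≡ 2 (mod 5)`,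
`#Ẽ(𝔽_ℓ)[5] = 5`), and surjective `ψ` with `kuriharaNumber D.f 5 6541 ψ ≠ 0` (`δ̃₆₅₄₁ ≡ 2 (mod 5)` on
engines 3a/4/B, kit j093174 / j093175 / j093207). A COMPUTATION read through a named theorem, not
proved here. CONDITIONAL; «not consumed by `_of`»; crux 19601 stays OPEN; nothing booked.
[cite: Kim2022StructureSelmer, Thm. 1.9 (1) and (6) (PDF pp. 7–8), §1.2.2, §1.4.3 (PDF p. 7)]
[cite: AgasheRibetStein2006, Thm. 2.6 and Thm. 5.2] [cite: Kobayashi2003, §4 + Thm. 4.1 (p. 8)] -/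
theorem stub_etaLower_rung_39675m1_of_namedFacts_of_kim
    (h22 : Kobayashi2003.thm22_etaSignedSelmerDual_finite_torsion)
    (h41 : Kobayashi2003.thm41_plusEtaCharIdeal_dvd)
    (hKO : KitajimaOtsuki2018.mainThm13_etaSignedSelmerDual_noFiniteSubmodule)
    (hmod : hasEntireLFunction_rat) (hGZK : rank_eq_analyticRank_of_analyticRank_le_one)
    (hKim : Kim2022_rankZero_padicValRat_sha_of_kuriharaNumber_ne_zero_of_maninConstant)
    (hsurjW : (⟨0, -1, 1, -506958, -159508807⟩ : WeierstrassCurve ℚ).HasSurjectiveModNGaloisRep 5)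
    (hLW : (⟨0, -1, 1, -506958, -159508807⟩ : WeierstrassCurve ℚ).entireLFunction 1 ≠ 0)
    {N : ℕ} [NeZero N]
    (D : ModularParametrizationData (⟨0, -1, 1, -506958, -159508807⟩ : WeierstrassCurve ℚ) N)
    (hc : ¬ (5 : ℤ) ∣ D.maninConstant)
    (hu : ∃ u : ℚ, padicNorm 5 u = 1 ∧
      (⟨0, -1, 1, -506958, -159508807⟩ : WeierstrassCurve ℚ).realPeriodRat = u * plusPeriod D.f)
    (hn : haveI := isGloballyMinimal_39675m1
      Kato.IsKolyvaginProduct (⟨0, -1, 1, -506958, -159508807⟩ : WeierstrassCurve ℚ) 5 1 6541)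
    (hcyc : haveI := isGloballyMinimal_39675m1
      ∀ (ℓ : ℕ) [Fact ℓ.Prime], ℓ ∣ 6541 →
        Nat.card {P : ((WeierstrassCurve.integralModelInt
            (⟨0, -1, 1, -506958, -159508807⟩ : WeierstrassCurve ℚ)).map
          (Int.castRingHom (ZMod ℓ))).toAffine.Point // 5 • P = 0} ≤ 5)
    (ψ : (ℓ : ℕ) → (ZMod ℓ)ˣ →* Multiplicative (ZMod (5 ^ 1)))
    (hψ : ∀ ℓ ∈ (6541 : ℕ).primeFactors, Function.Surjective (ψ ℓ))
    (hδ : kuriharaNumber D.f (5 ^ 1) 6541 ψ ≠ 0) :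
    ∀ (V : WeierstrassCurve ℚ) [V.IsElliptic] [V.IsGloballyMinimal] [Fact (5 : ℕ).Prime],
      (∃ C : VariableChange ℚ,
        C • (⟨0, -1, 1, -506958, -159508807⟩ : WeierstrassCurve ℚ).quadraticTwist 5 = V) →
      V.HasGoodReductionAtPrime 5 → V.frobeniusTrace 5 = 0 →
      (∀ m : ℕ, V.HasSurjectiveModNGaloisRep (5 ^ m : ℕ)) →
        QuadraticBranchPlusEtaLowerInclusionAt V 5 := by
  intro V _ _ _ hC _ _ hsurj
  obtain ⟨C, hCV⟩ := hC
  haveI := isElliptic_39675m1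
  haveI := isGloballyMinimal_39675m1
  have h5 : ((-1 : ℚ) ^ ((5 : ℕ) / 2) * ((5 : ℕ) : ℚ)) = 5 := by norm_num
  have hCV' : C • (⟨0, -1, 1, -506958, -159508807⟩ : WeierstrassCurve ℚ).quadraticTwist
      ((-1 : ℚ) ^ ((5 : ℕ) / 2) * ((5 : ℕ) : ℚ)) = V := by rw [h5]; exact hCV
  obtain ⟨u, hu1, hu2⟩ := hu
  have hu' : ∃ u : ℚ, ‖(u : ℚ_[5])‖ = 1 ∧
      (⟨0, -1, 1, -506958, -159508807⟩ : WeierstrassCurve ℚ).realPeriodRat = u * plusPeriod D.f :=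
    ⟨u, by rw [Padic.eq_padicNorm, hu1, Rat.cast_one], hu2⟩
  exact quadraticBranchPlusEtaLowerInclusionAt_of_namedFacts_of_kim h22 h41 hKO hmod hGZK hKim _ C
    le_rfl hCV' hsurj hsurjW hLW D hc hu' 6541 hn (fun ℓ _ hℓ => hcyc ℓ hℓ) ψ hψ hδ

end Summit.BirchSwinnertonDyer.BirchSwinnertonDyer.Theorems

end
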